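import Mathlib
import Literature.MathematicalPhysics.QuantumLattice.SectorSpectrum
import Summits.HubbardSuperconductivity.HubbardSuperconductivity.Theorems.BalabanIRBirEveryGroundStateSchur
import HarnessLib

/-!
# Seam flow: telescoping Hellmann–Feynman comparison of two pencils sharing one perturbation

Route `SeamInduction`, crux `SeamGluingLocality` (stmt-HubbardSuperconductivity-18509), line
`seam_flow` (crux workfile `Cruxes/SeamGluingLocality/Lines/seam_flow.lean`), tool stub S1
`StubSeamFlow` — here proved in its general form (no hermiticity or invariance hypotheses are
needed; they only serve to PRODUCE the ground-state witnesses, which this lemma takes as data).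

Setting: matrices `A`, `B`, `V` on `ℂⁿ`, a sector `K ≤ ℂⁿ` containing a unit vector, and the two
affine pencils `t ↦ A + tV`, `t ↦ B + tV` with sector energies
`f(t) = minEnergyOn (A + tV) K`, `g(t) = minEnergyOn (B + tV) K` (`Matrix.minEnergyOn`, the infimum
of `re ⟨ψ, · ψ⟩` over unit vectors of `K`). **Claim** (`seamFlow_comparison`): if at every partial
coupling `t ∈ (0, 1]` SOME sector ground states `φₜ` of `A + tV` and `ψₜ` of `B + tV` satisfy
`re ⟨φₜ, V φₜ⟩ ≤ re ⟨ψₜ, V ψₜ⟩ + ε`, then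
`g(0) - f(0) ≤ g(1) - f(1) + ε`, i.e. `minEnergyOn B K - minEnergyOn A K ≤
minEnergyOn (B + V) K - minEnergyOn (A + V) K + ε`.

Proof (elementary, no derivatives): on the grid `tⱼ = j/N` price each increment of `f` from
above with the LEFT ground state (`f(tⱼ₊₁) ≤ f(tⱼ) + h·re⟨φ_{tⱼ}, V φ_{tⱼ}⟩`, the variational
principle at `tⱼ₊₁` with trial state `φ_{tⱼ}`) and each increment of `g` from below with the RIGHT
ground state (`g(tⱼ₊₁) - g(tⱼ) ≥ h·re⟨ψ_{tⱼ₊₁}, V ψ_{tⱼ₊₁}⟩`); the first `f`-increment (no witness at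
`t = 0`) and the last `g`-witness cost `h·Σ|V_{ij}|` each; the sums telescope at equal `t`, giving
`[f(1) - f(0)] - [g(1) - g(0)] ≤ ε + (2Σ|V_{ij}| + |ε|)/N` for every `N ≥ 1`; let `N → ∞`.

In the line this is used with `A = H_⊕ + Tw 0`, `B = H_⊕ + Tw(π/3)` (decoupled two-tube
Hamiltonian at the two twists), `V = H_M(0) - H_⊕(0)` (the θ-independent seam operator) and
`K = szSector N 0`: the `O(L)` seam energy cancels between the two twists at equal coupling and
only its twist-SENSITIVITY survives (`gluingTwistMonotone_of_pointwise` in the workfile). This is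
the finite-dimensional "coupling-constant integration" / Hellmann–Feynman bookkeeping (Feynman,
Phys. Rev. 56 (1939) 340; Griffiths, Phys. Rev. 152 (1966) 240 §II, supergradients of the concave
sector energy; Tasaki, *Physics and Mathematics of Quantum Many-Body Systems* (2020) §2.1,
variational principle in a sector). Folklore; no definition is introduced; no route file is
imported (Theses-free, importable by any closing module).

## Tree search
REUSED: `Matrix.minEnergyOn` (FinDimSpectrum), `exists_smul_unit` (SectorSpectrum), and from the
Theses-free Theorems module `BalabanIRBirEveryGroundStateSchur` the variational principle
`minEnergyOn_le_re_rayleigh` (no hermiticity) and the crude bound `neg_sum_norm_le_re_rayleigh`.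
The supergradient inequality exists for HERMITIAN pencils as `minEnergyOn_pencil_le_of_ground`
(GriffithsLemmaGroundStates); the hermiticity-free form is re-derived here in three lines.
`lean search 'seamFlow|telescop.*minEnergyOn'`: no hit.
-/

noncomputable section

set_option linter.dupNamespace false -- `Summit.<S>.<S>` doubles the summit name (tree convention)

namespace Summit.HubbardSuperconductivity.HubbardSuperconductivity.Theorems

open Matrix Finset
open Literature.MathematicalPhysics.QuantumLattice

section SeamFlow

variable {n : Type*} [Fintype n]

/-- Crude two-sided bound `|re ⟨ψ, V ψ⟩| ≤ Σ_{i,j} |V_{ij}|` for a unit vector `ψ`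
(`neg_sum_norm_le_re_rayleigh` for `V` and `-V`). Tasaki (2020) §2.1. [folklore] -/
theorem seamFlow_abs_re_rayleigh_le (V : Matrix n n ℂ) {ψ : n → ℂ} (hψ : star ψ ⬝ᵥ ψ = 1) :
    |(star ψ ⬝ᵥ V *ᵥ ψ).re| ≤ ∑ i, ∑ j, ‖V i j‖ := by
  have hlo := neg_sum_norm_le_re_rayleigh V hψ
  have hhi := neg_sum_norm_le_re_rayleigh (-V) hψ
  rw [neg_mulVec, dotProduct_neg, Complex.neg_re] at hhi
  simp only [Matrix.neg_apply, norm_neg] at hhi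
  exact abs_le.mpr ⟨hlo, by linarith⟩

/-- **Supergradient step** along the pencil `t ↦ A + tV`: a sector ground state `φ` at coupling
`t` (a unit vector of `K` realising `minEnergyOn (A + tV) K`) is a trial state at every other
coupling `s`, so `minEnergyOn (A + sV) K ≤ minEnergyOn (A + tV) K + (s - t)·re ⟨φ, V φ⟩`.
Griffiths, Phys. Rev. 152 (1966) 240 §II; Tasaki (2020) §2.1. [folklore] -/
theorem seamFlow_pencil_le_of_ground (A V : Matrix n n ℂ) (K : Submodule ℂ (n → ℂ)) {t : ℝ}
    {φ : n → ℂ} (hφK : φ ∈ K) (hφ : star φ ⬝ᵥ φ = 1)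
    (hg : (star φ ⬝ᵥ (A + (t : ℂ) • V) *ᵥ φ).re = (A + (t : ℂ) • V).minEnergyOn K) (s : ℝ) :
    (A + (s : ℂ) • V).minEnergyOn K ≤
      (A + (t : ℂ) • V).minEnergyOn K + (s - t) * (star φ ⬝ᵥ V *ᵥ φ).re := by
  have h := minEnergyOn_le_re_rayleigh (A + (s : ℂ) • V) K hφK hφ
  rw [add_mulVec, dotProduct_add, Complex.add_re, smul_mulVec, dotProduct_smul, smul_eq_mul,
    Complex.re_ofReal_mul] at h hg
  have e : (s - t) * (star φ ⬝ᵥ V *ᵥ φ).re =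
      s * (star φ ⬝ᵥ V *ᵥ φ).re - t * (star φ ⬝ᵥ V *ᵥ φ).re := by ring
  linarith

/-- **First step of the flow without a witness**: for `0 ≤ h`,
`minEnergyOn (A + hV) K ≤ minEnergyOn A K + h·Σ|V_{ij}|` whenever `K` contains a unit vector
(every unit `ψ ∈ K` is a trial state for `A + hV`, and `re ⟨ψ, V ψ⟩ ≤ Σ|V_{ij}|`; take the infimum
over `ψ`). Tasaki (2020) §2.1. [folklore] -/
theorem seamFlow_minEnergyOn_add_smul_le (A V : Matrix n n ℂ) (K : Submodule ℂ (n → ℂ))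
    (hne : ∃ ψ ∈ K, star ψ ⬝ᵥ ψ = 1) {h : ℝ} (hh : 0 ≤ h) :
    (A + (h : ℂ) • V).minEnergyOn K ≤ A.minEnergyOn K + h * ∑ i, ∑ j, ‖V i j‖ := by
  obtain ⟨ψ₀, hψ₀K, hψ₀⟩ := hne
  have key : (A + (h : ℂ) • V).minEnergyOn K - h * ∑ i, ∑ j, ‖V i j‖ ≤ A.minEnergyOn K := by
    refine le_csInf ⟨_, ψ₀, hψ₀K, hψ₀, rfl⟩ ?_
    rintro E ⟨ψ, hψK, hψ, rfl⟩
    have h1 := minEnergyOn_le_re_rayleigh (A + (h : ℂ) • V) K hψK hψ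
    rw [add_mulVec, dotProduct_add, Complex.add_re, smul_mulVec, dotProduct_smul, smul_eq_mul,
      Complex.re_ofReal_mul] at h1
    have h2 := (abs_le.mp (seamFlow_abs_re_rayleigh_le V hψ)).2
    nlinarith [mul_le_mul_of_nonneg_left h2 hh]
  linarith

/-- **Seam flow / telescoping Hellmann–Feynman comparison** (tool S1 of line `seam_flow`, general
form). For matrices `A`, `B`, `V` and a sector `K ≠ ⊥`: if at every partial coupling `t ∈ (0, 1]`
some sector ground states `φ` of `A + tV` and `ψ` of `B + tV` (unit vectors of `K` realising
`minEnergyOn`) have `re ⟨φ, V φ⟩ ≤ re ⟨ψ, V ψ⟩ + ε`, then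
`minEnergyOn B K - minEnergyOn A K ≤ minEnergyOn (B + V) K - minEnergyOn (A + V) K + ε` —
switching on a common perturbation `V` along which the `A`-ground states never gain more `V` than
the `B`-ground states (up to `ε`) cannot lower the gap `g - f` by more than `ε`. Grid telescoping as
in the module docstring; `t = 0` is never used as a witness point. Feynman (1939); Griffiths,
Phys. Rev. 152 (1966) 240 §II; Tasaki (2020) §2.1. [folklore] -/
theorem seamFlow_comparison (K : Submodule ℂ (n → ℂ)) (A B V : Matrix n n ℂ) (ε : ℝ)
    (hK : K ≠ ⊥)
    (hw : ∀ t ∈ Set.Ioc (0 : ℝ) 1, ∃ φ ψ : n → ℂ, φ ∈ K ∧ ψ ∈ K ∧ star φ ⬝ᵥ φ = 1 ∧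
      star ψ ⬝ᵥ ψ = 1 ∧
      (star φ ⬝ᵥ (A + (t : ℂ) • V) *ᵥ φ).re = (A + (t : ℂ) • V).minEnergyOn K ∧
      (star ψ ⬝ᵥ (B + (t : ℂ) • V) *ᵥ ψ).re = (B + (t : ℂ) • V).minEnergyOn K ∧
      (star φ ⬝ᵥ V *ᵥ φ).re ≤ (star ψ ⬝ᵥ V *ᵥ ψ).re + ε) :
    B.minEnergyOn K - A.minEnergyOn K ≤ (B + V).minEnergyOn K - (A + V).minEnergyOn K + ε := by
  -- a unit vector in `K`
  obtain ⟨v, hvK, hv0⟩ := (Submodule.ne_bot_iff K).1 hK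
  obtain ⟨c, -, hc1⟩ := exists_smul_unit hv0
  have hne : ∃ ψ ∈ K, star ψ ⬝ᵥ ψ = 1 := ⟨c • v, K.smul_mem c hvK, hc1⟩
  -- total witness functions
  have hw' : ∀ t : ℝ, ∃ φ ψ : n → ℂ, t ∈ Set.Ioc (0 : ℝ) 1 → (φ ∈ K ∧ ψ ∈ K ∧
      star φ ⬝ᵥ φ = 1 ∧ star ψ ⬝ᵥ ψ = 1 ∧
      (star φ ⬝ᵥ (A + (t : ℂ) • V) *ᵥ φ).re = (A + (t : ℂ) • V).minEnergyOn K ∧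
      (star ψ ⬝ᵥ (B + (t : ℂ) • V) *ᵥ ψ).re = (B + (t : ℂ) • V).minEnergyOn K ∧
      (star φ ⬝ᵥ V *ᵥ φ).re ≤ (star ψ ⬝ᵥ V *ᵥ ψ).re + ε) := by
    intro t
    by_cases ht : t ∈ Set.Ioc (0 : ℝ) 1
    · obtain ⟨φ, ψ, h⟩ := hw t ht
      exact ⟨φ, ψ, fun _ => h⟩
    · exact ⟨0, 0, fun h => (ht h).elim⟩
  choose φ ψ hspec using hw'
  set R : ℝ := ∑ i, ∑ j, ‖V i j‖ with hR
  have hR0 : 0 ≤ R := by positivity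
  set f : ℝ → ℝ := fun t => (A + (t : ℂ) • V).minEnergyOn K with hf
  set g : ℝ → ℝ := fun t => (B + (t : ℂ) • V).minEnergyOn K with hg
  set yg : ℝ → ℝ := fun t => (star (ψ t) ⬝ᵥ V *ᵥ (ψ t)).re with hyg
  -- one-step inequalities at witness points
  have stepF : ∀ t ∈ Set.Ioc (0 : ℝ) 1, ∀ s : ℝ, t ≤ s → f s ≤ f t + (s - t) * (yg t + ε) := by
    intro t ht s hts
    obtain ⟨hφK, -, hφ1, -, hφg, -, hV⟩ := hspec t ht
    have h1 := seamFlow_pencil_le_of_ground A V K hφK hφ1 hφg s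
    have h2 : (s - t) * (star (φ t) ⬝ᵥ V *ᵥ (φ t)).re ≤ (s - t) * (yg t + ε) :=
      mul_le_mul_of_nonneg_left hV (sub_nonneg.mpr hts)
    simp only [hf]
    linarith
  have stepG : ∀ t ∈ Set.Ioc (0 : ℝ) 1, ∀ s : ℝ, g s ≤ g t + (s - t) * yg t := by
    intro t ht s
    obtain ⟨-, hψK, -, hψ1, -, hψg, -⟩ := hspec t ht
    exact seamFlow_pencil_le_of_ground B V K hψK hψ1 hψg s
  have ygR : ∀ t ∈ Set.Ioc (0 : ℝ) 1, |yg t| ≤ R := by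
    intro t ht
    obtain ⟨-, -, -, hψ1, -⟩ := hspec t ht
    exact seamFlow_abs_re_rayleigh_le V hψ1
  have hf0 : f 0 = A.minEnergyOn K := by
    simp only [hf, Complex.ofReal_zero, zero_smul, add_zero]
  have hg0 : g 0 = B.minEnergyOn K := by
    simp only [hg, Complex.ofReal_zero, zero_smul, add_zero]
  have hf1 : f 1 = (A + V).minEnergyOn K := by
    simp only [hf, Complex.ofReal_one, one_smul]
  have hg1 : g 1 = (B + V).minEnergyOn K := by
    simp only [hg, Complex.ofReal_one, one_smul]
  -- the grid estimate
  have grid : ∀ N : ℕ, 0 < N → (f 1 - f 0) - (g 1 - g 0) ≤ ε + (2 * R + |ε|) / N := by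
    intro N hN
    have hNr : (0 : ℝ) < N := by exact_mod_cast hN
    have hmem : ∀ j : ℕ, 1 ≤ j → j ≤ N → ((j : ℝ) / N) ∈ Set.Ioc (0 : ℝ) 1 := by
      intro j hj hjN
      refine ⟨div_pos (by exact_mod_cast hj) hNr, ?_⟩
      rw [div_le_one hNr]
      exact_mod_cast hjN
    have claim : ∀ j : ℕ, 1 ≤ j → j ≤ N →
        (f ((j : ℝ) / N) - f 0) - (g ((j : ℝ) / N) - g 0) ≤
          1 / N * R + ((j : ℝ) - 1) * (1 / N) * ε - 1 / N * yg ((j : ℝ) / N) := by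
      intro j hj
      induction j, hj using Nat.le_induction with
      | base =>
        intro h1N
        have ht : ((1 : ℕ) : ℝ) / N ∈ Set.Ioc (0 : ℝ) 1 := hmem 1 le_rfl h1N
        have e1 : f (((1 : ℕ) : ℝ) / N) ≤ f 0 + 1 / N * R := by
          have := seamFlow_minEnergyOn_add_smul_le A V K hne (h := ((1 : ℕ) : ℝ) / N)
            (by positivity)
          rw [hf0]
          simpa only [hf, Nat.cast_one] using this
        have e2 := stepG _ ht 0
        have e3 : (0 - ((1 : ℕ) : ℝ) / N) * yg (((1 : ℕ) : ℝ) / N) =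
            -(1 / N * yg (((1 : ℕ) : ℝ) / N)) := by push_cast; ring
        rw [e3] at e2
        have e4 : (((1 : ℕ) : ℝ) - 1) * (1 / N) * ε = 0 := by push_cast; ring
        rw [e4]
        linarith
      | succ j hj ih =>
        intro hjN
        have ih' := ih (by omega)
        have htj : ((j : ℝ) / N) ∈ Set.Ioc (0 : ℝ) 1 := hmem j hj (by omega)
        have htj1 : (((j + 1 : ℕ) : ℝ) / N) ∈ Set.Ioc (0 : ℝ) 1 := hmem (j + 1) (by omega) hjN
        have hle : (j : ℝ) / N ≤ ((j + 1 : ℕ) : ℝ) / N := by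
          gcongr
          exact_mod_cast (Nat.le_succ j)
        have hdiff : ((j + 1 : ℕ) : ℝ) / N - (j : ℝ) / N = 1 / N := by
          push_cast; ring
        have e1 := stepF _ htj _ hle
        rw [hdiff] at e1
        have e2 := stepG _ htj1 ((j : ℝ) / N)
        have hdiff' : ((j : ℝ) / N - ((j + 1 : ℕ) : ℝ) / N) = -(1 / N) := by
          push_cast; ring
        rw [hdiff'] at e2
        have e5 : (((j + 1 : ℕ) : ℝ) - 1) * (1 / N) * ε = ((j : ℝ) - 1) * (1 / N) * ε + 1 / N * ε := by
          push_cast; ring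
        rw [e5]
        nlinarith [e1, e2, ih']
    have hD := claim N hN le_rfl
    have hNN : (N : ℝ) / N = 1 := div_self hNr.ne'
    rw [hNN] at hD
    have hy1 : |yg 1| ≤ R := ygR 1 ⟨zero_lt_one, le_rfl⟩
    have hy1' := (abs_le.mp hy1).1
    have e6 : ((N : ℝ) - 1) * (1 / N) * ε = ε - ε / N := by
      field_simp
    rw [e6] at hD
    have e7 : -(ε / N) ≤ |ε| / N := by
      rw [neg_le, ← neg_div]
      exact div_le_div_of_nonneg_right (neg_abs_le ε) hNr.le
    have e8 : 1 / (N : ℝ) * R - 1 / N * yg 1 ≤ 2 * R / N := by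
      rw [div_mul_eq_mul_div, one_mul, div_mul_eq_mul_div, one_mul, ← sub_div,
        div_le_div_iff_of_pos_right hNr]
      linarith
    have e9 : ε + (2 * R + |ε|) / N = ε + 2 * R / N + |ε| / N := by
      rw [add_div, add_assoc]
    rw [e9]
    linarith
  -- let `N → ∞`
  have lim : (f 1 - f 0) - (g 1 - g 0) ≤ ε := by
    refine le_of_forall_pos_le_add fun η hη => ?_
    obtain ⟨N, hN⟩ := exists_nat_gt ((2 * R + |ε|) / η)
    have hC : 0 ≤ 2 * R + |ε| := by positivity
    have hNpos : (0 : ℝ) < N := lt_of_le_of_lt (div_nonneg hC hη.le) hN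
    have hN0 : 0 < N := by exact_mod_cast hNpos
    have h1 := grid N hN0
    have h2 : (2 * R + |ε|) / N < η := by
      rw [div_lt_iff₀ hNpos]
      rw [div_lt_iff₀ hη] at hN
      linarith [mul_comm η (N : ℝ)]
    linarith
  rw [hf0, hg0, hf1, hg1] at lim
  linarith

end SeamFlow

end Summit.HubbardSuperconductivity.HubbardSuperconductivity.Theorems
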